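import Literature.NumberTheory.Transcendental.CurvePeriodsEllipticPathsProofs
import HarnessLib

/-!
# Crux `RealOnePeriodRelations` (stmt-KontsevichZagierPeriods-10042), line `nash-retraction-thin-strip`:
# stub `stub_ellNormalForm` — the lift normal form on ONE elliptic curve

For a period pair `L` with algebraic invariants `g₂, g₃` (CM allowed) and a finite set `T` of
period symbols on the Weierstrass curve `E_L`, there are `ℤ`-linearly independent algebraic
logarithms `m_1, …, m_r`, a generic algebraic base point `t₀` and basis lifts
`D_l : t₀ ↝ t₀ + m_l` such that every `s ∈ T` is, modulo the elementary relations,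
`liftPart A B + e·𝟙` with algebraic `A, B, e`, and `(m_l, ζ(t₀ + m_l) − ζ(t₀))` exponentiates to
a `ℚ̄`-point of `E♮`.

This is phases A–D of the tree's one-curve theorem
`CurvePeriods.huberWustholzCurvePeriods_of_ellipticPaths`
(`Literature/NumberTheory/Transcendental/CurvePeriodsEllipticPathsProofs.lean`), isolated and
with the support of a combination replaced by an arbitrary finite set of symbols on `E_L`:

* Phase A — every symbol `(E_L, ω, γ)` is `a S₀[D] + b S₁[D] + e𝟙` for a lift `D : z₀ ↝ z₁` of `γ`
  (`Ell.exists_liftData_rel`);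
* Phase B — the displacements `w_s = z₁ − z₀` generate a free `ℤ`-module of algebraic logarithms,
  with a `ℤ`-basis `m_1, …, m_r` (`Module.basisOfFiniteTypeTorsionFree'`);
* Phase C — a generic algebraic base point `t₀` (`Ell.exists_generic_algPt`) avoiding the finite
  bad sets of `Ell.zexpand` and of the translations, and basis lifts `D_l : t₀ ↝ t₀ + m_l`
  (`Ell.LiftData.nonempty`);
* Phase D — translation invariance `S[z₀ ↝ z₁] ∼ S[t₀ ↝ t₀ + w_s]`
  (`Ell.LiftData.span_translate_theta0/1`) and the `ℤ`-linear expansion through the basis lifts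
  (`Ell.zexpand`).

The points `(m_l, ζ(t₀ + m_l) − ζ(t₀))` are `ℚ̄`-points of `E♮` by `Ell.isUnivExtAlgPoint_shift`.
No hypothesis on complex multiplication is needed: CM only enters the transcendence step.

References: A. Huber, G. Wüstholz, *Transcendence and Linear Relations of 1-Periods*, Cambridge
Tracts in Mathematics 227, CUP 2022, §13.2 (p. 123), §18.1 (p. 160). [HuberWustholz2022]
-/

noncomputable section

open scoped BigOperators PeriodPair Topology
open MvPolynomial Set Complex Filter Metric
open Literature.NumberTheory.Transcendental Literature.NumberTheory.Transcendental.CurvePeriods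

set_option quotPrecheck false in
/-- Membership in the `ℚ̄`-span of the elementary relations (the conclusion format of
`HuberWustholzCurvePeriods`). [cite: HuberWustholz2022, §13.2 (p. 123), §18.1 (p. 160)] -/
local notation "InSpan" c:max => ∃ (k : ℕ) (ρ : Fin k → (PeriodSymbol →₀ ℂ)) (a : Fin k → ℂ),
  (∀ l, IsElementaryRelation (ρ l)) ∧ (∀ l, IsAlgebraic ℚ (a l)) ∧ c = ∑ l, a l • ρ l

namespace Summit.KontsevichZagierPeriods.SymplecticScissors.RealOnePeriodRelations.MultiEllLayer

/-- **The lift normal form on ONE curve** (phases A–D of the tree's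
`huberWustholzCurvePeriods_of_ellipticPaths`, isolated): for a lattice `L` with algebraic
invariants and a finite set `T` of symbols on `E_L`, there are `ℤ`-linearly independent algebraic
logarithms `m_1, …, m_r`, a generic algebraic base point `t₀` and basis lifts
`D_l : t₀ ↝ t₀ + m_l` such that every `s ∈ T` is, modulo the elementary relations,
`liftPart A B + e·𝟙` with algebraic `A, B, e`; and `(m_l, ζ(t₀ + m_l) − ζ(t₀))` is a `ℚ̄`-point of
`E♮` (`Ell.exists_liftData_rel`, `Ell.exists_generic_algPt`, `Module.basisOfFiniteTypeTorsionFree'`,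
`Ell.LiftData.span_translate_theta0/1`, `Ell.zexpand`, `Ell.isUnivExtAlgPoint_shift`).
No CM hypothesis. [cite: HuberWustholz2022, §13.2 (p. 123), §18.1 (p. 160)] -/
theorem stub_ellNormalForm (L : PeriodPair) (h₂ : IsAlgebraic ℚ L.g₂) (h₃ : IsAlgebraic ℚ L.g₃)
    (T : Finset PeriodSymbol) (hT : ∀ s ∈ T, s.Z = Ell.curve L) :
    ∃ (r : ℕ) (m : Fin r → ℂ) (t₀ : ℂ) (DU : ∀ l : Fin r, Ell.LiftData L t₀ (t₀ + m l)),
      LinearIndependent ℤ m ∧ (∀ l, Ell.AlgLog L (m l)) ∧ Ell.IsAlgPt L t₀ ∧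
      (∀ l, L.IsUnivExtAlgPoint (m l) (L.weierstrassZeta (t₀ + m l) - L.weierstrassZeta t₀)) ∧
      ∀ s ∈ T, ∃ (A B : Fin r → ℂ) (e : ℂ), (∀ l, IsAlgebraic ℚ (A l)) ∧ (∀ l, IsAlgebraic ℚ (B l)) ∧
        IsAlgebraic ℚ e ∧
        InSpan (Finsupp.single s (1 : ℂ) - Ell.liftPart h₂ h₃ DU A B - e • Finsupp.single PeriodSymbol.unit (1 : ℂ)) := by
  classical
  have hg00 : Ell.IsAlgPt L (Ell.vtx L 0 (0, 0)) := Ell.isAlgPt_vtx L h₂ h₃ 0 (0, 0)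
  set D00 : Ell.LiftData L (Ell.vtx L 0 (0, 0)) (Ell.vtx L 0 (0, 0)) := Ell.LiftData.const hg00
  -- Phase A: raw data of every symbol of `T`
  have key : ∀ s : PeriodSymbol, ∃ (z₀ z₁ : ℂ) (D : Ell.LiftData L z₀ z₁) (a b e₀ : ℂ), s ∈ T →
      (IsAlgebraic ℚ a ∧ IsAlgebraic ℚ b ∧ IsAlgebraic ℚ e₀ ∧
        InSpan (Finsupp.single s (1 : ℂ) -
          a • D.sym h₂ h₃ (Ell.theta0 L) (Ell.hasAlgCoeffs_theta0 L h₂ h₃) -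
          b • D.sym h₂ h₃ (Ell.theta1 L) (Ell.hasAlgCoeffs_theta1 L h₂ h₃) -
          e₀ • Finsupp.single PeriodSymbol.unit (1 : ℂ))) := by
    intro s
    by_cases hs : s ∈ T
    · have hsZ := hT s hs
      obtain ⟨Z, hZ, ω, hω, γ⟩ := s
      dsimp only at hsZ
      subst hsZ
      obtain rfl : hZ = Ell.smooth L h₂ h₃ := rfl
      obtain ⟨z₀, z₁, D, a, b, e₀, ha, hb, he, hrel⟩ := Ell.exists_liftData_rel h₂ h₃ ω hω γ
      exact ⟨z₀, z₁, D, a, b, e₀, fun _ => ⟨ha, hb, he, hrel⟩⟩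
    · exact ⟨_, _, D00, 0, 0, 0, fun h => (hs h).elim⟩
  choose z₀ z₁ Dl a b e₀ hkey using key
  -- Phase B: the ℤ-module generated by the lifted displacements `w s = z₁ s − z₀ s`
  set w : PeriodSymbol → ℂ := fun s => z₁ s - z₀ s with hw
  have hwA : ∀ s, Ell.AlgLog L (w s) := fun s =>
    ((Dl s).alg_stop.algLog).sub L h₂ (Dl s).alg_start.algLog
  set Wf : Finset ℂ := T.image w
  set Msp : Submodule ℤ ℂ := Submodule.span ℤ (Wf : Set ℂ)
  obtain ⟨r, bM⟩ : Σ n : ℕ, Module.Basis (Fin n) ℤ Msp := Module.basisOfFiniteTypeTorsionFree'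
  set m : Fin r → ℂ := fun l => (bM l : ℂ)
  have hMalg : ∀ x ∈ Msp, Ell.AlgLog L x := by
    intro x hx
    refine Submodule.span_induction (p := fun x _ => Ell.AlgLog L x) ?_ ?_ ?_ ?_ hx
    · intro x hx
      obtain ⟨s, _, rfl⟩ := Finset.mem_image.1 (Finset.mem_coe.1 hx)
      exact hwA s
    · exact Ell.algLog_zero
    · intro x y _ _ hx hy
      exact hx.add L h₂ hy
    · intro z x _ hx
      rw [zsmul_eq_mul]
      exact hx.zsmul L h₂ z
  have hmA : ∀ l, Ell.AlgLog L (m l) := fun l => hMalg _ (bM l).2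
  have hli : LinearIndependent ℤ m := by
    have h := bM.linearIndependent.map' Msp.subtype (Submodule.ker_subtype Msp)
    exact h
  -- integer coordinates of each `w s`
  have keyn : ∀ s : PeriodSymbol, ∃ n : Fin r → ℤ, s ∈ T → ∑ l, (n l : ℂ) * m l = w s := by
    intro s
    by_cases hs : s ∈ T
    · have hmem : w s ∈ Msp :=
        Submodule.subset_span (Finset.mem_coe.2 (Finset.mem_image_of_mem w hs))
      refine ⟨fun l => bM.repr ⟨w s, hmem⟩ l, fun _ => ?_⟩
      have h := congrArg (fun y : Msp => (y : ℂ)) (bM.sum_repr ⟨w s, hmem⟩)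
      simp only [Submodule.coe_sum, Submodule.coe_smul_of_tower, zsmul_eq_mul] at h
      exact h
    · exact ⟨0, fun h => (hs h).elim⟩
  choose n hn using keyn
  -- Phase C: the generic base point and the basis lifts
  choose Bexp hBexp using fun s : PeriodSymbol => Ell.zexpand (L := L) h₂ h₃ r m hmA (n s)
  set BD : PeriodSymbol → Finset ℂ := fun s => {z₀ s, 2 * z₀ s, z₀ s - z₁ s, z₀ s + z₁ s}
    with hBD
  set Bast : Finset ℂ := Finset.univ.biUnion fun l : Fin r => ({m l, -m l} : Finset ℂ)
  set Bset : Finset ℂ := (T.biUnion fun s => Bexp s ∪ BD s) ∪ Bast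
  obtain ⟨t₀, ht₀, hgen⟩ := Ell.exists_generic_algPt L h₂ h₃ Bset
  have hgen_exp : ∀ s ∈ T, ∀ b' ∈ Bexp s, t₀ - b' ∉ L.lattice := fun s hs b' hb' =>
    hgen b' (Finset.mem_union_left _ (Finset.mem_biUnion.2 ⟨s, hs, Finset.mem_union_left _ hb'⟩))
  have hgen_D : ∀ s ∈ T, ∀ b' ∈ BD s, t₀ - b' ∉ L.lattice := fun s hs b' hb' =>
    hgen b' (Finset.mem_union_left _ (Finset.mem_biUnion.2 ⟨s, hs, Finset.mem_union_right _ hb'⟩))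
  have hgen_ast : ∀ l, t₀ - m l ∉ L.lattice ∧ t₀ + m l ∉ L.lattice := fun l => by
    have h1 := hgen (m l)
      (Finset.mem_union_right _ (Finset.mem_biUnion.2 ⟨l, Finset.mem_univ _, by simp⟩))
    have h2 := hgen (-m l)
      (Finset.mem_union_right _ (Finset.mem_biUnion.2 ⟨l, Finset.mem_univ _, by simp⟩))
    exact ⟨h1, by simpa using h2⟩
  have hDUalg : ∀ l, Ell.IsAlgPt L (t₀ + m l) := fun l =>
    (ht₀.algLog.add L h₂ (hmA l)).isAlgPt (hgen_ast l).2
  set DU : ∀ l : Fin r, Ell.LiftData L t₀ (t₀ + m l) := fun l =>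
    (Ell.LiftData.nonempty (L := L) ht₀ (hDUalg l)).some
  -- Phase D: per symbol, `s ∼ liftPart (a n) (b n) + e' 𝟙`
  have hper : ∀ s ∈ T, ∃ e' : ℂ, IsAlgebraic ℚ e' ∧
      InSpan (Finsupp.single s (1 : ℂ) -
        Ell.liftPart h₂ h₃ DU (fun l => a s * (n s l : ℂ)) (fun l => b s * (n s l : ℂ)) -
        e' • Finsupp.single PeriodSymbol.unit (1 : ℂ)) := by
    intro s hs
    obtain ⟨ha, hb, he, hrel⟩ := hkey s hs
    -- genericity at `s`
    have hz0 : t₀ - z₀ s ∉ L.lattice := hgen_D s hs _ (by simp [hBD])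
    have h2z0 : t₀ - 2 * z₀ s ∉ L.lattice := hgen_D s hs _ (by simp [hBD])
    have hdiff : t₀ - (z₀ s - z₁ s) ∉ L.lattice := hgen_D s hs _ (by simp [hBD])
    have hsum01 : t₀ - (z₀ s + z₁ s) ∉ L.lattice := hgen_D s hs _ (by simp [hBD])
    set v : ℂ := t₀ - z₀ s with hv
    have hvA : Ell.AlgLog L v := ht₀.algLog.sub L h₂ (Dl s).alg_start.algLog
    have hvalg : Ell.IsAlgPt L v := hvA.isAlgPt hz0
    have hne0 : ℘[L] (z₀ s) ≠ ℘[L] v := by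
      refine (Ell.weierstrassP_ne_iff L (Dl s).alg_start.1 hvalg.1).2 ⟨?_, ?_⟩
      · have e1 : z₀ s + v = t₀ := by rw [hv]; ring
        rw [e1]; exact ht₀.1
      · intro h
        apply h2z0
        have e1 : t₀ - 2 * z₀ s = -(z₀ s - v) := by rw [hv]; ring
        rw [e1]; exact neg_mem h
    have hne1 : ℘[L] (z₁ s) ≠ ℘[L] v := by
      refine (Ell.weierstrassP_ne_iff L (Dl s).alg_stop.1 hvalg.1).2 ⟨?_, ?_⟩
      · have e1 : z₁ s + v = t₀ - (z₀ s - z₁ s) := by rw [hv]; ring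
        rw [e1]; exact hdiff
      · intro h
        apply hsum01
        have e1 : t₀ - (z₀ s + z₁ s) = -(z₁ s - v) := by rw [hv]; ring
        rw [e1]; exact neg_mem h
    have hws : Ell.IsAlgPt L (t₀ + w s) := by
      refine (ht₀.algLog.add L h₂ (hwA s)).isAlgPt ?_
      have e1 : t₀ + w s = t₀ - (z₀ s - z₁ s) := by rw [hw]; ring
      rw [e1]; exact hdiff
    obtain ⟨Dtr⟩ := Ell.LiftData.nonempty (L := L) (a := t₀) (b := t₀ + w s) ht₀ hws
    have ea : t₀ = z₀ s + v := by rw [hv]; ring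
    have eb : t₀ + w s = z₁ s + v := by rw [hv, hw]; ring
    -- translation
    have rt0 := Ell.LiftData.span_translate_theta0 h₂ h₃ hvalg (Dl s) (Dtr.cast ea eb) hne0 hne1
    have rt1 := Ell.LiftData.span_translate_theta1 h₂ h₃ hvalg (Dl s) (Dtr.cast ea eb) hne0 hne1
    rw [Ell.LiftData.sym_cast] at rt0 rt1
    have hκ := Ell.isAlgebraic_translate_const L hvalg (Dl s).alg_start (Dl s).alg_stop
    -- expansion
    obtain ⟨-, -, hall⟩ := hBexp s t₀ ht₀ (hgen_exp s hs)
    have esum : t₀ + w s = t₀ + ∑ l, (n s l : ℂ) * m l := by rw [hn s hs]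
    obtain ⟨rx0, cx, hcx, rx1⟩ := hall (Dtr.cast rfl esum) DU
    rw [Ell.LiftData.sym_cast] at rx0 rx1
    refine ⟨e₀ s + b s * (cx - (eval (Ell.psiT L v (z₁ s)) (Ell.rPolyT L v) -
        eval (Ell.psiT L v (z₀ s)) (Ell.rPolyT L v))), he.add (hb.mul (hcx.sub hκ)), ?_⟩
    obtain ⟨K, ρ, cf, hρ, hcf, hsum⟩ :=
      span_add (span_add hrel (span_smul ha (span_sub rx0 rt0))) (span_smul hb (span_sub rx1 rt1))
    refine ⟨K, ρ, cf, hρ, hcf, ?_⟩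
    rw [← hsum]
    simp only [Ell.liftPart, smul_sub, Finset.smul_sum, smul_smul, add_smul, sub_smul, mul_sub]
    abel
  -- assembly
  refine ⟨r, m, t₀, DU, hli, hmA, ht₀, fun l =>
    Ell.isUnivExtAlgPoint_shift ht₀ (hmA l) (hgen_ast l).2 (hgen_ast l).1, fun s hs => ?_⟩
  obtain ⟨e', he', hrel⟩ := hper s hs
  obtain ⟨ha, hb, -, -⟩ := hkey s hs
  have hnalg : ∀ l : Fin r, IsAlgebraic ℚ ((n s l : ℤ) : ℂ) := fun l => isAlgebraic_int _
  exact ⟨fun l => a s * (n s l : ℂ), fun l => b s * (n s l : ℂ), e', fun l => ha.mul (hnalg l),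
    fun l => hb.mul (hnalg l), he', hrel⟩

end Summit.KontsevichZagierPeriods.SymplecticScissors.RealOnePeriodRelations.MultiEllLayer

end
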